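import Summits.QuantumFields.BalabanUV.T4Continuum.Support.NE3SmoothLiftW
import HarnessLib

/-!
# T⁴ programme, node NE3 — route Π, row Π-R (curved step), file Π-R-W3: THE TRANSPORTED (COVARIANT) LIFT, THE COVARIANT CORRECTOR,
# AND THE EXACT IDENTITY `D_W (covLift φ + corrector) = QbarIter L (j+1) W (covLift φ)`

NE3 (node U1b) formalisation swarm, leaf seat `b2b-balaban-t4-ne3-formalise-leaf-01` (gen 8); FINDING F-ne3leaf01g8-1 (`HOME/CLAIMS.log`
2026-08-20 ≈23:04Z), which RE-PLANS row Π-R-W of ruling ρ-g25-1 (2).  WHY A NEW LIFT.  W2's comb-dressed flat lift (`NE3SmoothLiftW.smoothLiftW`)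
reads the LAST own-block bond of every κ-line un-rotated and the others through `Ad_{h₀⁻¹}` (`h₀ = W(line)`): exactly in d = 1,
`QbarIter W₀ (smoothLift φ) = (1 − c_M)Ad_{h₀⁻¹}φ + c_Mφ`, `c_M = 12(3M−4)∕(M(M+1)(M+2))`, singular at `M = 6` for `Ad`-eigenvalue `−1`; and
the flat interpolant of the accumulated frames gives a corrector of size `O(|φ|)` (not `O(|φ|∕M)`) on the face-crossing bonds of the comb gauge.
THE OBJECTS OF THIS FILE (canonical, gauge-covariant, no comb gauge in the definitions):
* **`covLift M W φ (x,κ) := Ad_{τ(x,κ)} (smoothLift M φ x κ)`**, `τ = W(Γ_{M•z, x+e_κ})⁻¹ · W(Γ_{M•z} straight to M•(z+e_κ))`, `z = blk M x`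
  (the tree's `btree`∕`bseg`): the coarse datum `φ(z,κ)`, which lives at the coarse endpoint `M•(z+e_κ)` in the right trivialisation,
  is carried back along the straight line to the corner and out along the taxi tree to the fine endpoint `x + e_κ`, then spread with
  Π-R♭-2's signed profile.  `covLift M 1 = smoothLift M` (`covLift_flat`); **covariance** `covLift M (W^g) (φ^{g∘M•}) = (covLift M W φ)^g`
  (`covLift_gaugeAct`); skew, periodic; `‖covLift M W φ x κ‖ = ‖smoothLift M φ x κ‖` (every size letter of Π-R♭-4 transfers verbatim).
* the corrector generator is this lineage's COVARIANT TENT INTERPOLANT `NE3CovariantTentInterpolant.tinterpW` (gen 6, K5c: each corner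
  value carried along ITS OWN taxi path — no per-block frame, hence no face) of MINUS the accumulated frame generator
  `framePotW L (j+1) W (covLift M W φ)` (leaf-04's `NE3TangentCovariantTower`), and **`hatInvW L j W φ := covLift + gaugeDir W (tinterpW … (−G))`**.
* THE EXACT IDENTITY **`dirIter_hatInvW`**: `dirIter L (j+1) W (hatInvW L j W φ) = QbarIter L (j+1) W (covLift (L^{j+1}) W φ)` — leaf-04's
  structure theorem `dirIter = QbarIter + gaugeDir ∘ framePotW`, `dirIter_gaugeDir` and `tinterpW_corner` kill the frame part EXACTLY,
  directly at `W` (no detour through the comb-gauged background).  What is LEFT for the exact right inverse is the straight part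
  `QbarIter L (j+1) W (covLift φ) ≈ φ` (W4, near-flat perturbation of the tower in regional comb gauges) and the near-identity solve (W5).

CONTENT ([folklore]; 0 sorry; DATA defs `liftHol`, `covLift`, `frameGen`, `hatInvW` → definition lane): §1 the transport and the lift
(flat case, isometry, skewness, periodicity, **gauge covariance**); §2 the generator and the corrector (skew, periodic, corner values;
`hatInvW_flat`: at `W = 1` the generator is H3's flat `interp` of minus the flat frame potential); §3 **`dirIter_hatInvW`**.

HONEST FRAMING.  Kinematics of OUR objects at one background in the multi-level small-field class; the curved right inverse is NOT yet
exact (W4∕W5 open); nothing about minimisers; (P♮)_W, T-E_w and **NE3 are NOT proved**; spine PROVED 0∕9; finite T⁴ rung (B)+1 — NOT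
infinite volume, NOT mass gap, NOT `BetaPertH`, NOT Clay.  PLACEMENT: `Summits/QuantumFields/BalabanUV/`.  HONEST DEPENDENCY (cell page 1):
continuum YM on T⁴ ⇐ BetaPertH ∧ nine spine estimates (0/9 proved); BetaPertH ⇐ (D1) ∧ (D4) ∧ CAP+tail; G-an2-4 gates asym, D1 and NE2/3/4.
-/

set_option autoImplicit false

open scoped BigOperators Matrix.Norms.L2Operator
open Finset

namespace Summit.QuantumFields.BalabanUV.T4Continuum.NE3CovariantLift

open Literature.MathematicalPhysics.QuantumFieldTheory.Balaban1983to89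
open B7Prop1Explicit B7Prop2Explicit
open T4AveragingDeficitWall (IsUnitaryCfg IsSkewDir SmallField Ad)
open T4AveragingDeficitWallBoundary (IsPeriodicCfg)
open T4AveragingDeficitNonAbelian (Ad_mul hol_add_period)
open AveragingDeficitPeriodicCounting (IsPeriodicDir)
open AveragingDeficitTransport (Ad_mem_skewAdjoint norm_Ad_of_unitary)
open AveragingDeficitNearIdentity (Ad_add Ad_one Ad_zero Ad_neg Ad_real_smul)
open AveragingDeficitChartCalculus (cavg)
open AveragingDeficitMultiLevelPrep (cavgIter LevelSmall tower natCast_tower_succ tower_ne_zero)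
open AveragingDeficitBlockDensity (btree bseg btree_mem bseg_mem btree_add_period bseg_add_period)
open BlockAveragePushDirGauge (gaugeDir)
open BlockAveragePushDirSplit (flat)
open SmoothRefineBlocks (blk res blk_res_add_period blk_res_smul)
open NE3TangentCovariantStructure (gaugeDir_add_fun)
open NE3TangentCovariantTower (dirIter QbarIter framePotW dirIter_add_gaugeDir dirIter_eq_QbarIter_add_gaugeDir)
open NE3CombGauge (btree_corner)
open NE3CovariantTentInterpolant (tinterpW hol_flat tinterpW_flat tinterpW_corner tinterpW_mem_skewAdjoint tinterpW_add_period)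
open NE3SmoothLiftFlat (smoothLift)
open NE3SmoothRightInverseBounds (smoothLift_add_period)
open NE3SmoothLiftW (framePotW_skew framePotW_add_period isSkewDir_smoothLift tower_eq_pow_mul gaugeDir_zero_fun)

noncomputable section

variable {d : ℕ} {n : Type*} [Fintype n] [DecidableEq n]

/-! ## §1 The transport and the covariant lift -/

/-- **THE TRANSPORT OF THE LIFT**: `τ(x,κ) = W(Γ_{M•z, x+e_κ})⁻¹ · W([M•z, M•(z+e_κ)])`, `z = blk M x` — the tree's `btree`∕`bseg`. [folklore] -/
def liftHol (M : ℕ) (W : Site d → Fin d → (Matrix n n ℂ)ˣ) (x : Site d) (κ : Fin d) : (Matrix n n ℂ)ˣ :=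
  (btree M W (blk M x) (x + e κ))⁻¹ * bseg M W (blk M x) κ

/-- **THE COVARIANT (TRANSPORTED) LIFT** `covLift M W φ (x,κ) := Ad_{τ(x,κ)} (smoothLift M φ x κ)`. [folklore] -/
def covLift (M : ℕ) (W : Site d → Fin d → (Matrix n n ℂ)ˣ) (φ : Site d → Fin d → Matrix n n ℂ) : Site d → Fin d → Matrix n n ℂ :=
  fun x κ => Ad (liftHol M W x κ) (smoothLift M φ x κ)

/-- The transport is unitary at a unitary background. [folklore] -/
theorem liftHol_mem {W : Site d → Fin d → (Matrix n n ℂ)ˣ} (hWu : IsUnitaryCfg W) (M : ℕ) (x : Site d) (κ : Fin d) :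
    liftHol M W x κ ∈ unitaryUnits (Matrix n n ℂ) :=
  (unitaryUnits _).mul_mem ((unitaryUnits _).inv_mem (btree_mem hWu M _ _)) (bseg_mem hWu M _ κ)

/-- At `W = 1` the transport is `1`. [folklore] -/
theorem liftHol_flat (M : ℕ) (x : Site d) (κ : Fin d) : liftHol M (flat (d := d) (n := n)) x κ = 1 := by
  unfold liftHol btree bseg
  rw [hol_flat, hol_flat, inv_one, one_mul]

/-- **FLAT CASE**: `covLift M 1 = smoothLift M`. [folklore] -/
theorem covLift_flat (M : ℕ) (φ : Site d → Fin d → Matrix n n ℂ) : covLift M (flat (d := d) (n := n)) φ = smoothLift M φ := by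
  funext x κ
  simp only [covLift, liftHol_flat, Ad_one]

/-- The lift as the transported coarse datum times the scalar profile. [folklore] -/
theorem covLift_eq_smul (M : ℕ) (W : Site d → Fin d → (Matrix n n ℂ)ˣ) (φ : Site d → Fin d → Matrix n n ℂ) (x : Site d) (κ : Fin d) :
    covLift M W φ x κ = ((NE3SmoothLiftFlat.liftNorm d M)⁻¹ * (NE3SmoothLiftProfile.lprof M (res M x κ) * NE3SmoothLiftFlat.tperp M κ x))
      • Ad (liftHol M W x κ) (φ (blk M x) κ) := by
  simp only [covLift, smoothLift, Ad_real_smul]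

/-- **ISOMETRY**: `‖covLift M W φ x κ‖ = ‖smoothLift M φ x κ‖` at a unitary background — every size letter of Π-R♭-4 transfers. [folklore] -/
theorem norm_covLift_eq {W : Site d → Fin d → (Matrix n n ℂ)ˣ} (hWu : IsUnitaryCfg W) (M : ℕ) (φ : Site d → Fin d → Matrix n n ℂ)
    (x : Site d) (κ : Fin d) : ‖covLift M W φ x κ‖ = ‖smoothLift M φ x κ‖ := by
  unfold covLift
  exact norm_Ad_of_unitary (liftHol_mem hWu M x κ) _

/-- The covariant lift of a skew coarse field at a unitary background is skew. [folklore] -/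
theorem isSkewDir_covLift {W : Site d → Fin d → (Matrix n n ℂ)ˣ} (hWu : IsUnitaryCfg W) (M : ℕ) {φ : Site d → Fin d → Matrix n n ℂ}
    (hφ : IsSkewDir φ) : IsSkewDir (covLift M W φ) := fun x κ =>
  Ad_mem_skewAdjoint (liftHol_mem hWu M x κ) (isSkewDir_smoothLift M hφ x κ)

/-- Periodicity of the transport: `(M·N)`-periodic `W` gives an `(M·N)`-periodic `τ` (`M ≥ 1`). [folklore] -/
theorem liftHol_add_period {M : ℕ} (hM : 1 ≤ M) {N : ℕ} {W : Site d → Fin d → (Matrix n n ℂ)ˣ} (hWP : IsPeriodicCfg W ((M : ℤ) * N))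
    (x : Site d) (τ κ : Fin d) : liftHol M W (x + ((M * N : ℕ) : ℤ) • e τ) κ = liftHol M W x κ := by
  obtain ⟨hb, -⟩ := blk_res_add_period (d := d) hM x (N : ℤ) τ
  have hP : ((M * N : ℕ) : ℤ) = (M : ℤ) * (N : ℤ) := by push_cast; ring
  unfold liftHol
  rw [hP, hb, show x + ((M : ℤ) * (N : ℤ)) • e τ + e κ = x + e κ + ((M : ℤ) * (N : ℤ)) • e τ by abel,
    btree_add_period M hWP (blk M x) (x + e κ) τ, bseg_add_period M hWP (blk M x) κ τ]

/-- **PERIODICITY**: `N`-periodic `φ` and `(M·N)`-periodic `W` give an `(M·N)`-periodic lift (`M ≥ 1`). [folklore] -/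
theorem covLift_add_period {M : ℕ} (hM : 1 ≤ M) {N : ℕ} {W : Site d → Fin d → (Matrix n n ℂ)ˣ} (hWP : IsPeriodicCfg W ((M : ℤ) * N))
    {φ : Site d → Fin d → Matrix n n ℂ} (hφ : IsPeriodicDir φ (N : ℤ)) :
    IsPeriodicDir (covLift M W φ) ((M * N : ℕ) : ℤ) := by
  intro x τ κ
  simp only [covLift]
  rw [liftHol_add_period hM hWP x τ κ, smoothLift_add_period hM (fun z τ' κ' => hφ z τ' κ') x τ κ]

/-- The transport dresses covariantly: `τ_{W^g}(x,κ) = g(x+e_κ) · τ_W(x,κ) · g(M•(z+e_κ))⁻¹`, `z = blk M x`. [folklore] -/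
theorem liftHol_gaugeAct (M : ℕ) (g : Site d → (Matrix n n ℂ)ˣ) (W : Site d → Fin d → (Matrix n n ℂ)ˣ) (x : Site d) (κ : Fin d) :
    liftHol M (gaugeAct g W) x κ = g (x + e κ) * liftHol M W x κ * (g ((M : ℤ) • (blk M x + e κ)))⁻¹ := by
  unfold liftHol btree bseg
  rw [hol_gaugeAct, hol_gaugeAct, disp_treeWord, disp_seg, add_sub_cancel, smul_add]
  simp only [mul_inv_rev, inv_inv, mul_assoc, inv_mul_cancel_left]

/-- **GAUGE COVARIANCE OF THE LIFT**: `covLift M (W^g) (φ^{g∘M•}) = (covLift M W φ)^g`, where a coarse field dresses at its coarse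
endpoint (`φ^{g∘M•}(z,κ) = Ad_{g(M•(z+e_κ))} φ(z,κ)`) and a fine field at its fine endpoint. [folklore] -/
theorem covLift_gaugeAct (M : ℕ) (g : Site d → (Matrix n n ℂ)ˣ) (W : Site d → Fin d → (Matrix n n ℂ)ˣ) (φ : Site d → Fin d → Matrix n n ℂ) :
    covLift M (gaugeAct g W) (fun z κ => Ad (g ((M : ℤ) • (z + e κ))) (φ z κ))
      = fun x κ => Ad (g (x + e κ)) (covLift M W φ x κ) := by
  funext x κ
  rw [covLift_eq_smul, covLift_eq_smul, Ad_real_smul, liftHol_gaugeAct, Ad_mul, Ad_mul, ← Ad_mul _ (g _), inv_mul_cancel, Ad_one]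

/-! ## §2 The accumulated frame generator of the lift and the covariant corrector -/

/-- THE ACCUMULATED FRAME GENERATOR of the covariant lift through the `(j+1)`-fold average (leaf-04's `framePotW`). [folklore] -/
def frameGen (L j : ℕ) (W : Site d → Fin d → (Matrix n n ℂ)ˣ) (φ : Site d → Fin d → Matrix n n ℂ) : Site d → Matrix n n ℂ :=
  framePotW L (j + 1) W (covLift (L ^ (j + 1)) W φ)

/-- **`R̂_W φ := covLift φ + gaugeDir W (tinterpW M W (−G))`**, `G = frameGen`, `M = L^{j+1}`: the lift plus the covariant pure-gauge corrector
generated by the covariant tent interpolant of minus the accumulated frames. [folklore] -/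
def hatInvW (L j : ℕ) (W : Site d → Fin d → (Matrix n n ℂ)ˣ) (φ : Site d → Fin d → Matrix n n ℂ) : Site d → Fin d → Matrix n n ℂ :=
  fun x μ => covLift (L ^ (j + 1)) W φ x μ + gaugeDir W (tinterpW (L ^ (j + 1)) W (fun z => -frameGen L j W φ z)) x μ

/-- At `W = 1` the corrector generator is H3's flat interpolant of minus the flat frame potential of the flat lift. [folklore] -/
theorem hatInvW_flat (L j : ℕ) (φ : Site d → Fin d → Matrix n n ℂ) :
    hatInvW L j (flat (d := d) (n := n)) φ = fun x μ => smoothLift (L ^ (j + 1)) φ x μ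
      + gaugeDir (flat (d := d) (n := n)) (SmoothRefineInterp.interp (L ^ (j + 1)) Finset.univ
          (fun z => -framePotW L (j + 1) flat (smoothLift (L ^ (j + 1)) φ) z)) x μ := by
  funext x μ
  simp only [hatInvW, frameGen, covLift_flat]
  congr 2
  funext y
  exact tinterpW_flat _ _ y

section Class

variable [Nonempty n] {L : ℕ} (hL : 2 ≤ L) (j : ℕ) {N : ℕ} [NeZero N] {W : Site d → Fin d → (Matrix n n ℂ)ˣ} {x : ℝ}
  (hWu : IsUnitaryCfg W) (hWP : IsPeriodicCfg W ((tower L N (j + 1) : ℕ) : ℤ)) (hx : 0 ≤ x) (hs : LevelSmall d L j x) (hWx : SmallField W x)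
  {φ : Site d → Fin d → Matrix n n ℂ} (hφ : IsSkewDir φ) (hφP : IsPeriodicDir φ (N : ℤ))

include hL hWP hφP in
omit [Nonempty n] [NeZero N] in
/-- The covariant lift is periodic with the fine period `tower L N (j+1) = L^{j+1}·N`. [folklore] -/
theorem covLift_add_period_tower : IsPeriodicDir (covLift (L ^ (j + 1)) W φ) ((tower L N (j + 1) : ℕ) : ℤ) := by
  have hM1 : 1 ≤ L ^ (j + 1) := Nat.one_le_pow _ _ (by omega)
  have hT : ((tower L N (j + 1) : ℕ) : ℤ) = (((L ^ (j + 1) : ℕ) : ℤ)) * N := by rw [tower_eq_pow_mul]; push_cast; ring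
  have hWP' : IsPeriodicCfg W ((((L ^ (j + 1) : ℕ) : ℤ)) * N) := by rw [← hT]; exact hWP
  intro y i μ
  rw [hT, show (((L ^ (j + 1) : ℕ) : ℤ)) * (N : ℤ) = ((L ^ (j + 1) * N : ℕ) : ℤ) by push_cast; ring]
  exact covLift_add_period hM1 hWP' hφP y i μ

include hL hWu hx hs hWx hφ in
omit [NeZero N] in
/-- The accumulated frame generator of the lift is 𝔲(n)-valued. [folklore] -/
theorem frameGen_skew (z : Site d) : frameGen L j W φ z ∈ skewAdjoint (Matrix n n ℂ) :=
  framePotW_skew (by omega) j hWu hx hs hWx (isSkewDir_covLift hWu _ hφ) z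

include hL hWP hφP in
omit [Nonempty n] [NeZero N] in
/-- The accumulated frame generator of the lift is `N`-periodic. [folklore] -/
theorem frameGen_add_period (z : Site d) (i : Fin d) : frameGen L j W φ (z + (N : ℤ) • e i) = frameGen L j W φ z :=
  framePotW_add_period L j hWP (covLift_add_period_tower hL j hWP hφP) z i

include hL hWu hWP hx hs hWx hφ hφP in
/-- **THE EXACT IDENTITY OF THE CURVED RIGHT INVERSE (frame part killed)**: for `L ≥ 2`, a unitary `(L^{j+1}·N)`-periodic `W` in the
multi-level small-field class and a skew `N`-periodic coarse `φ`,
`dirIter L (j+1) W (hatInvW L j W φ) = QbarIter L (j+1) W (covLift (L^{j+1}) W φ)`. [folklore] -/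
theorem dirIter_hatInvW :
    dirIter L (j + 1) W (hatInvW L j W φ) = QbarIter L (j + 1) W (covLift (L ^ (j + 1)) W φ) := by
  have hL1 : 1 ≤ L := by omega
  have hM1 : 1 ≤ L ^ (j + 1) := Nat.one_le_pow _ _ hL1
  set M := L ^ (j + 1) with hMdef
  set A := covLift M W φ with hAdef
  set G := frameGen L j W φ with hGdef
  set lam : Site d → Matrix n n ℂ := fun y => tinterpW M W (fun z => -G z) y with hlam
  have hT : ((tower L N (j + 1) : ℕ) : ℤ) = ((M : ℕ) : ℤ) * N := by rw [tower_eq_pow_mul]; push_cast; rw [hMdef]; push_cast; ring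
  have hWP' : IsPeriodicCfg W (((M : ℕ) : ℤ) * N) := by rw [← hT]; exact hWP
  -- the lift: skew and periodic
  have hAs : IsSkewDir A := isSkewDir_covLift hWu M hφ
  have hAP : IsPeriodicDir A ((tower L N (j + 1) : ℕ) : ℤ) := covLift_add_period_tower hL j hWP hφP
  -- the generator: skew, periodic, with the right corner values
  have hnegGs : ∀ z, (fun z => -G z) z ∈ skewAdjoint (Matrix n n ℂ) := fun z =>
    (skewAdjoint (Matrix n n ℂ)).neg_mem (frameGen_skew hL j hWu hx hs hWx hφ z)
  have hnegGP : ∀ (z : Site d) (i : Fin d), (fun z => -G z) (z + (N : ℤ) • e i) = (fun z => -G z) z := fun z i => by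
    simp only [hGdef, frameGen_add_period hL j hWP hφP z i]
  have hlams : ∀ y, lam y ∈ skewAdjoint (Matrix n n ℂ) := fun y => tinterpW_mem_skewAdjoint M hWu hnegGs y
  have hlamP : ∀ (y : Site d) (i : Fin d), lam (y + ((tower L N (j + 1) : ℕ) : ℤ) • e i) = lam y := by
    intro y i
    rw [hT, show ((M : ℕ) : ℤ) * (N : ℤ) = ((M * N : ℕ) : ℤ) by push_cast; ring]
    exact tinterpW_add_period hM1 hWP' hnegGP y i
  have hcorner : ∀ z : Site d, lam (((L : ℤ) ^ (j + 1)) • z) = -G z := fun z => by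
    rw [show ((L : ℤ) ^ (j + 1)) = ((M : ℕ) : ℤ) by rw [hMdef]; push_cast; ring]
    exact tinterpW_corner hM1 W (fun z => -G z) z
  -- assemble
  have hR : hatInvW L j W φ = fun y μ => A y μ + gaugeDir W lam y μ := rfl
  rw [hR, dirIter_add_gaugeDir (M := N) hL1 j hWu hWP hx hs hWx A hlams hlamP,
    dirIter_eq_QbarIter_add_gaugeDir (M := N) hL1 j hWu hWP hx hs hWx hAs hAP]
  funext z κ
  beta_reduce
  rw [add_assoc, ← gaugeDir_add_fun]
  have h0 : (fun w => framePotW L (j + 1) W A w + lam (((L : ℤ) ^ (j + 1)) • w)) = fun _ => (0 : Matrix n n ℂ) := by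
    funext w
    rw [hcorner]
    show frameGen L j W φ w + -frameGen L j W φ w = 0
    rw [add_neg_cancel]
  rw [h0, gaugeDir_zero_fun, add_zero]

end Class

end

end Summit.QuantumFields.BalabanUV.T4Continuum.NE3CovariantLift
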